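import Summits.CriticalPhenomena.PercolationContinuityZ3.Theorems.PercNearOneGluingNoHeavyQuantHalfMeanTransport
import Literature.Probability.LatticeModels.ProdBernoulliBlocks
import HarnessLib

/-!
# QUANT lane R8: FAR for independent legs (spiders) — the far-relay row beyond blobs

builds on p205010 (kernel theorem, internal audit signed; external expert review pending)

Support file (`--supports stmt-CriticalPhenomena-4575`), QUANT lane seat prim-quant-census-1 (gen 6), rung R8 of
`run/shared/lean/prim/quant/LADDER.md`, for the R8 target of record `Quant.FarRelayRow` (lead g4, p214662) and the
lead's next target "FAR on trees" (`prim-quant-lead-g5/LEAD-NOTES-G5.md` N13).  Memo: `run/shared/lean/prim/quant/CENSUS-GAIN.md` §14.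
Theorems only; no definitions, no sorries, standard axioms.

**Setting (a spider in gate coordinates).**  `ι` is a finite set of gates (= edges of a tree in which only the root
branches; the relay sits at the lower endpoint of its gate), `leg : ι → J` says on which leg a gate lies and
`depth : ι → ℕ` how far down.  Under `prodBernoulli p` the gate `y` is open with probability `p y`, independently.
The relay below gate `x` is connected to the root iff every gate of the same leg at depth `≤ depth x` is open, i.e. iff
`↑(P x) ⊆ ω` with `P x = {y | leg y = leg x ∧ depth y ≤ depth x}`; its marginal is `T x = ∏_{y ∈ P x} p y`, the
observer's relay count is `N(ω) = #{x | ↑(P x) ⊆ ω}` and `E N = Σ_x T x`.  Equivalently `N = Σ_j M_j` with INDEPENDENT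
legs of ARBITRARY law on `{0, …, m_j}` — beyond the independent-blob caricature (`Quant.halfMean_smallBall`, `M_j ∈ {0, a_j}`)
and exactly where the edge-level transport of N13 (2) fails.  Equal depths on a leg = glued gates; a non-relay vertex on a
leg is a gate merged into the next one (series reduction).

* `Quant.far_indepLegs` — **FAR for spiders, every layer:** `2j < Σ_x T x` and `1 − T x ≤ t` for all `x` imply
  `P(N ≤ j) ≤ t`; i.e. `E N > 2j ⟹ P(N ≤ j) ≤ max_x P(root ↮ x)` — the instance of `Quant.FarRelayRow` on every spider
  (in gate coordinates).  `Quant.far_indepLegs_root`: the `o ∈ A` cell (`N + 1` relays, layer `j + 1`).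
* PROOF, three regimes.  (A) a leg with `≥ j+1` gates: on `{N ≤ j}` its full prefix is not open (`1 − T z ≤ t`).
  (C) `t ≤ 1/2` (`Quant.indepLegs_smallBall_of_card`, NO mean hypothesis): TOP-BLOB DOMINATION `N ≥ Σ_j m_j·1[leg j open]`;
  the readings "leg fully open" are product Bernoulli on `J` (block principle `prodBernoulli_real_preimage_readBlocks`) with
  gates `≥ 1 − t ≥ 1/2`, so p2's transport `Quant.halfMean_smallBall_of_card` applies.  (B) `t ≥ 1/2`, all legs `≤ j` gates
  (`Quant.indepLegs_cantelli`): `E M_j² ≤ m_j E M_j`, `E M_j ≥ m_j(1 − t)` ⟹ `Var N ≤ j t E N`; Markov on `(m − N + (m − j))²`.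
* Census (CENSUS-GAIN §14, kit j096181): 110.9 M exact independent-leg instances, 0 violations, equality only with a unit
  gate; every intermediate inequality of (A)/(B)/(C) re-checked exactly on 1.8 M instances.  Branching trees: see §14.

Nearest prior art searched (corpus hybrid + galaxy, 2026-08-20; lead g5 N12 and postcont g16 searches for the blob case):
Hoeffding 1956 (Bernoulli legs), Feige 2006 / Paley–Zygmund type bounds at `E X + 1`; no statement with arbitrary bounded
legs at half the mean and the constant `max_x P(x unreached)` found. [cite: KozmaNitzan2024, Lemma 2 (p. 6), Conjecture 3 (p. 15)]
-/

noncomputable section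

namespace Summit.CriticalPhenomena.PercolationContinuityZ3.Theorems

open MeasureTheory Set Finset
open Literature.Probability.LatticeModels
open Literature.Probability.Percolation (prodBernoulli_real_eq_sum_weight_ind)
open Literature.Probability.Percolation.BHK2006 (weight weight_nonneg)
open Literature.Probability.Percolation.DecisionTree (ind ind_of_mem ind_of_not_mem ind_nonneg)
open scoped Classical

namespace Quant

variable {ι J : Type*} [Fintype ι] [Fintype J]

/-- **High-marginal small-ball bound for independent legs (no mean hypothesis).**  Gates `ι` on legs `leg : ι → J`
with depths; if every relay marginal satisfies `1 − ∏_{y ∈ P x} p y ≤ t ≤ 1/2` and there are at least `2j+1` gates, then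
`P(#{x | P x open} ≤ j) ≤ t`.  Proof: `N ≥ Σ_j #(leg j)·1[leg j fully open]`, the readings "leg fully open" form a product
Bernoulli configuration on `J` (block principle), and `Quant.halfMean_smallBall_of_card` applies to it. [this work] -/
theorem indepLegs_smallBall_of_card (leg : ι → J) (depth : ι → ℕ) (p : ι → unitInterval) (j : ℕ) (t : ℝ)
    (ht2 : t ≤ 1 / 2)
    (ht : ∀ x, 1 - ∏ y ∈ univ.filter (fun y => leg y = leg x ∧ depth y ≤ depth x), (p y : ℝ) ≤ t)
    (hcard : 2 * j + 1 ≤ Fintype.card ι) :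
    (prodBernoulli p).real {ω : Set ι |
      (univ.filter (fun x => ((univ.filter (fun y => leg y = leg x ∧ depth y ≤ depth x) : Finset ι) : Set ι) ⊆ ω)).card ≤ j} ≤ t := by
  set μ := prodBernoulli p with hμ
  set P : ι → Finset ι := fun x => univ.filter (fun y => leg y = leg x ∧ depth y ≤ depth x) with hP
  set E : Set (Set ι) := {ω : Set ι | (univ.filter (fun x => ((P x : Finset ι) : Set ι) ⊆ ω)).card ≤ j} with hE
  have hp0 : ∀ i, (0 : ℝ) ≤ p i := fun i => (p i).2.1
  have hp1 : ∀ i, (p i : ℝ) ≤ 1 := fun i => (p i).2.2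
  set F : J → Finset ι := fun j' => univ.filter (fun x => leg x = j') with hF
  have hPF : ∀ x, P x ⊆ F (leg x) := fun x y hy => by
    simp only [hP, hF, Finset.mem_filter, Finset.mem_univ, true_and] at hy ⊢; exact hy.1
  have hdeep : ∀ j', (F j').Nonempty → ∃ x ∈ F j', P x = F j' := by
    intro j' hne
    obtain ⟨x, hx, hmax⟩ := Finset.exists_max_image (F j') depth hne
    refine ⟨x, hx, Finset.Subset.antisymm (by
      have : leg x = j' := by simpa [hF] using hx
      rw [← this]; exact hPF x) fun y hy => ?_⟩
    have hlx : leg x = j' := by simpa [hF] using hx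
    have hly : leg y = j' := by simpa [hF] using hy
    simp only [hP, Finset.mem_filter, Finset.mem_univ, true_and]
    exact ⟨hly.trans hlx.symm, hmax y hy⟩
  have hcardF : (univ : Finset ι).card = ∑ j', (F j').card :=
    Finset.card_eq_sum_card_fiberwise fun x _ => Finset.mem_univ (leg x)
  have hne : (univ : Finset ι).Nonempty := Finset.card_pos.1 (by rw [Finset.card_univ]; omega)
  obtain ⟨x₀, -⟩ := hne
  have hT1x : ∏ y ∈ P x₀, (p y : ℝ) ≤ 1 := Finset.prod_le_one (fun y _ => hp0 y) fun y _ => hp1 y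
  have ht0 : 0 ≤ t := by linarith [ht x₀]
  set g : J → Set ι → Prop := fun j' ω => ((F j' : Finset ι) : Set ι) ⊆ ω with hg
  have hloc : IsBlockLocal leg g := by
    intro j' ω ω' hagree
    simp only [hg, Set.subset_def, Finset.mem_coe]
    refine forall_congr' fun e => ?_
    refine imp_congr_right fun he => ?_
    have : leg e = j' := by simpa [hF] using he
    exact hagree e this
  have hmeas : ∀ j', Measurable (g j') := fun j' => Measurable.of_discrete
  set q : J → unitInterval := fun j' => ⟨∏ y ∈ F j', (p y : ℝ),
    Finset.prod_nonneg fun y _ => hp0 y, Finset.prod_le_one (fun y _ => hp0 y) fun y _ => hp1 y⟩ with hq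
  have hq' : ∀ j', μ.real {ω | g j' ω} = q j' := fun j' => prodBernoulli_real_subset p (F j')
  have hqt : ∀ j', 1 - (q j' : ℝ) ≤ t := by
    intro j'
    rcases (F j').eq_empty_or_nonempty with h0 | hne'
    · have : (q j' : ℝ) = 1 := by simp [hq, h0]
      rw [this]; linarith
    · obtain ⟨x, -, hx⟩ := hdeep j' hne'
      have : (q j' : ℝ) = ∏ y ∈ P x, (p y : ℝ) := by simp only [hq]; rw [hx]
      rw [this]; exact ht x
  have hT : 2 * j + 1 ≤ ∑ j', (F j').card := by rw [← hcardF, Finset.card_univ]; exact hcard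
  -- the light event is contained in the preimage of the blob light event
  set L : Set (Set J) := {S : Set J | ∑ j' ∈ univ.filter (fun j' => j' ∈ S), (F j').card ≤ j} with hL
  have hsub : E ⊆ (fun ω => {j' | g j' ω}) ⁻¹' L := by
    intro ω hω
    simp only [Set.mem_preimage, hL, Set.mem_setOf_eq]
    have hωE : (univ.filter (fun x => ((P x : Finset ι) : Set ι) ⊆ ω)).card ≤ j := hω
    -- the open fibres are disjoint and all their gates are reached
    set S' : Finset J := univ.filter (fun j' => j' ∈ {j'' | g j'' ω}) with hS'
    have hdisj : ∀ a ∈ S', ∀ b ∈ S', a ≠ b → Disjoint (F a) (F b) := by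
      intro a _ b _ hab
      rw [Finset.disjoint_left]
      intro x hxa hxb
      have h1 : leg x = a := by simpa [hF] using hxa
      have h2 : leg x = b := by simpa [hF] using hxb
      exact hab (h1.symm.trans h2)
    have hbi : (S'.biUnion F).card = ∑ j' ∈ S', (F j').card := Finset.card_biUnion hdisj
    have hincl : S'.biUnion F ⊆ univ.filter (fun x => ((P x : Finset ι) : Set ι) ⊆ ω) := by
      intro x hx
      rw [Finset.mem_biUnion] at hx
      obtain ⟨j', hj', hxj⟩ := hx
      have hgj : ((F j' : Finset ι) : Set ι) ⊆ ω := by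
        have : j' ∈ {j'' | g j'' ω} := by simpa [hS'] using hj'
        exact this
      have hlx : leg x = j' := by simpa [hF] using hxj
      simp only [Finset.mem_filter, Finset.mem_univ, true_and]
      intro y hy
      have hy' : y ∈ F j' := by rw [← hlx]; exact hPF x (Finset.mem_coe.1 hy)
      exact hgj (Finset.mem_coe.2 hy')
    calc ∑ j' ∈ S', (F j').card = (S'.biUnion F).card := hbi.symm
      _ ≤ (univ.filter (fun x => ((P x : Finset ι) : Set ι) ⊆ ω)).card := Finset.card_le_card hincl
      _ ≤ j := hωE
  have hpre : μ.real ((fun ω => {j' | g j' ω}) ⁻¹' L) = (prodBernoulli q).real L :=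
    prodBernoulli_real_preimage_readBlocks p leg hloc hmeas q hq' MeasurableSet.of_discrete
  calc μ.real E ≤ μ.real ((fun ω => {j' | g j' ω}) ⁻¹' L) := measureReal_mono hsub (measure_ne_top _ _)
    _ = (prodBernoulli q).real L := hpre
    _ ≤ t := halfMean_smallBall_of_card q (fun j' => (F j').card) j t ht2 hqt hT


omit [Fintype J] in
/-- **Cantelli bound for independent legs.**  With `T x = ∏_{y ∈ P x} p y`, `m = Σ_x T x > j`, every leg carrying at most
`j` gates and `1 − T x ≤ t` for all `x`: `4 (m − j)² · P(N ≤ j) ≤ j·t·m + (m − j)²`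
(`E M_leg² ≤ m_leg E M_leg`, `E M_leg ≥ m_leg (1 − t)`, hence `Var N ≤ j t m`; Markov on `(m − N + (m − j))²`).
[folklore; Cantelli 1928 / one-sided Chebyshev] -/
theorem indepLegs_cantelli (leg : ι → J) (depth : ι → ℕ) (p : ι → unitInterval) (j : ℕ) (t : ℝ)
    (hfib : ∀ x, (univ.filter (fun y => leg y = leg x)).card ≤ j)
    (ht : ∀ x, 1 - ∏ y ∈ univ.filter (fun y => leg y = leg x ∧ depth y ≤ depth x), (p y : ℝ) ≤ t)
    (hjm : (j : ℝ) < ∑ x, ∏ y ∈ univ.filter (fun y => leg y = leg x ∧ depth y ≤ depth x), (p y : ℝ)) :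
    4 * ((∑ x, ∏ y ∈ univ.filter (fun y => leg y = leg x ∧ depth y ≤ depth x), (p y : ℝ)) - j) ^ 2 *
        (prodBernoulli p).real {ω : Set ι |
          (univ.filter (fun x => ((univ.filter (fun y => leg y = leg x ∧ depth y ≤ depth x) : Finset ι) : Set ι) ⊆ ω)).card ≤ j} ≤
      (j : ℝ) * t * (∑ x, ∏ y ∈ univ.filter (fun y => leg y = leg x ∧ depth y ≤ depth x), (p y : ℝ)) +
        ((∑ x, ∏ y ∈ univ.filter (fun y => leg y = leg x ∧ depth y ≤ depth x), (p y : ℝ)) - j) ^ 2 := by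
  set μ := prodBernoulli p with hμ
  set P : ι → Finset ι := fun x => univ.filter (fun y => leg y = leg x ∧ depth y ≤ depth x) with hP
  set T : ι → ℝ := fun x => ∏ y ∈ P x, (p y : ℝ) with hT
  set E : Set (Set ι) := {ω : Set ι | (univ.filter (fun x => ((P x : Finset ι) : Set ι) ⊆ ω)).card ≤ j} with hE
  set m : ℝ := ∑ x, T x with hm
  set lam : ℝ := m - j with hlam
  set W : Set ι → ℝ := weight (fun e => (p e : ℝ)) with hW
  set X : Set ι → ℝ := fun s => ∑ x, ind {ω : Set ι | ((P x : Finset ι) : Set ι) ⊆ ω} s with hX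
  have hp0 : ∀ i, (0 : ℝ) ≤ p i := fun i => (p i).2.1
  have hp1 : ∀ i, (p i : ℝ) ≤ 1 := fun i => (p i).2.2
  have hT0 : ∀ x, 0 ≤ T x := fun x => Finset.prod_nonneg fun y _ => hp0 y
  have hT1 : ∀ x, T x ≤ 1 := fun x => Finset.prod_le_one (fun y _ => hp0 y) fun y _ => hp1 y
  have hW0 : ∀ s, 0 ≤ W s := fun s => weight_nonneg hp0 hp1 s
  have hW1 : ∑ s, W s = 1 := by
    have h := prodBernoulli_real_eq_sum_weight_ind p (Set.univ : Set (Set ι))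
    rw [probReal_univ] at h
    rw [h]
    refine Finset.sum_congr rfl fun s _ => ?_
    rw [ind_of_mem (Set.mem_univ s), mul_one]
  have hW2 : ∀ Q : Finset ι, ∑ s, W s * ind {ω : Set ι | ((Q : Finset ι) : Set ι) ⊆ ω} s = ∏ y ∈ Q, (p y : ℝ) := by
    intro Q
    rw [← prodBernoulli_real_eq_sum_weight_ind p {ω : Set ι | ((Q : Finset ι) : Set ι) ⊆ ω}, prodBernoulli_real_subset]
  have hW3 : ∀ (Q Q' : Finset ι) (s : Set ι),
      ind {ω : Set ι | ((Q : Finset ι) : Set ι) ⊆ ω} s * ind {ω : Set ι | ((Q' : Finset ι) : Set ι) ⊆ ω} s =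
        ind {ω : Set ι | (((Q ∪ Q' : Finset ι)) : Set ι) ⊆ ω} s := by
    intro Q Q' s
    rw [← Literature.Probability.Percolation.BHK2006.ind_inter]
    congr 1
    ext ω
    simp only [Set.mem_inter_iff, Set.mem_setOf_eq, Finset.coe_union, Set.union_subset_iff]
  have hmean : ∑ s, W s * X s = m := by
    simp_rw [hX, Finset.mul_sum]
    rw [Finset.sum_comm]
    exact Finset.sum_congr rfl fun x _ => hW2 (P x)
  have hQ : ∑ s, W s * X s ^ 2 = ∑ x, ∑ x', ∏ y ∈ P x ∪ P x', (p y : ℝ) := by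
    have hsq : ∀ s, X s ^ 2 = ∑ x, ∑ x', ind {ω : Set ι | (((P x ∪ P x' : Finset ι)) : Set ι) ⊆ ω} s := by
      intro s
      rw [hX, sq, Finset.sum_mul_sum]
      refine Finset.sum_congr rfl fun x _ => Finset.sum_congr rfl fun x' _ => hW3 (P x) (P x') s
    simp_rw [hsq, Finset.mul_sum]
    rw [Finset.sum_comm]
    refine Finset.sum_congr rfl fun x _ => ?_
    rw [Finset.sum_comm]
    exact Finset.sum_congr rfl fun x' _ => hW2 (P x ∪ P x')
  have hm2 : m ^ 2 = ∑ x, ∑ x', T x * T x' := by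
    rw [hm, sq, Finset.sum_mul_sum]
  have hvar : ∑ s, W s * (X s - m) ^ 2 = ∑ x, ∑ x', (∏ y ∈ P x ∪ P x', (p y : ℝ) - T x * T x') := by
    have hexp : ∀ s, W s * (X s - m) ^ 2 = W s * X s ^ 2 - 2 * m * (W s * X s) + m ^ 2 * W s := by
      intro s; ring
    simp_rw [hexp]
    rw [Finset.sum_add_distrib, Finset.sum_sub_distrib, ← Finset.mul_sum, ← Finset.mul_sum, hmean, hW1, hQ]
    have : ∑ x, ∑ x', ∏ y ∈ P x ∪ P x', (p y : ℝ) - 2 * m * m + m ^ 2 * 1 =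
        ∑ x, ∑ x', ∏ y ∈ P x ∪ P x', (p y : ℝ) - m ^ 2 := by ring
    rw [this, hm2, ← Finset.sum_sub_distrib]
    refine Finset.sum_congr rfl fun x _ => ?_
    rw [← Finset.sum_sub_distrib]
  -- pairwise bound: different legs cancel, same leg gives at most `t · T x'`
  have hpair : ∀ x x', ∏ y ∈ P x ∪ P x', (p y : ℝ) - T x * T x' ≤ if leg x = leg x' then t * T x' else 0 := by
    intro x x'
    by_cases hl : leg x = leg x'
    · rw [if_pos hl]
      -- `∏_{P x ∪ P x'} ≤ ∏_{P x'} = T x'`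
      have hsub : P x' ⊆ P x ∪ P x' := Finset.subset_union_right
      have hle : ∏ y ∈ P x ∪ P x', (p y : ℝ) ≤ T x' := by
        rw [hT]
        show ∏ y ∈ P x ∪ P x', (p y : ℝ) ≤ ∏ y ∈ P x', (p y : ℝ)
        rw [← Finset.prod_sdiff hsub]
        have h1 : ∏ y ∈ (P x ∪ P x') \ P x', (p y : ℝ) ≤ 1 :=
          Finset.prod_le_one (fun y _ => hp0 y) fun y _ => hp1 y
        have h2 : 0 ≤ ∏ y ∈ P x', (p y : ℝ) := Finset.prod_nonneg fun y _ => hp0 y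
        nlinarith
      have h3 : 1 - T x ≤ t := ht x
      have h4 : 0 ≤ T x' := hT0 x'
      nlinarith
    · rw [if_neg hl]
      have hdisj : Disjoint (P x) (P x') := by
        rw [Finset.disjoint_left]
        intro y hy hy'
        simp only [hP, Finset.mem_filter, Finset.mem_univ, true_and] at hy hy'
        exact hl (hy.1.symm.trans hy'.1)
      rw [Finset.prod_union hdisj]
      simp [hT]
  -- variance bound `Var ≤ j t m`
  have hvarle : ∑ s, W s * (X s - m) ^ 2 ≤ (j : ℝ) * t * m := by
    rw [hvar]
    calc ∑ x, ∑ x', (∏ y ∈ P x ∪ P x', (p y : ℝ) - T x * T x')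
        ≤ ∑ x, ∑ x', (if leg x = leg x' then t * T x' else 0) :=
          Finset.sum_le_sum fun x _ => Finset.sum_le_sum fun x' _ => hpair x x'
      _ = ∑ x', ∑ x, (if leg x = leg x' then t * T x' else 0) := Finset.sum_comm
      _ = ∑ x', ((univ.filter (fun x => leg x = leg x')).card : ℝ) * (t * T x') := by
          refine Finset.sum_congr rfl fun x' _ => ?_
          rw [← Finset.sum_filter, Finset.sum_const, nsmul_eq_mul]
      _ ≤ ∑ x', (j : ℝ) * (t * T x') := by
          refine Finset.sum_le_sum fun x' _ => ?_
          have h1 : ((univ.filter (fun x => leg x = leg x')).card : ℝ) ≤ j := by exact_mod_cast hfib x'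
          have ht0' : 0 ≤ t := le_trans (by linarith [hT1 x']) (ht x')
          exact mul_le_mul_of_nonneg_right h1 (mul_nonneg ht0' (hT0 x'))
      _ = (j : ℝ) * t * m := by rw [hm, Finset.mul_sum]; exact Finset.sum_congr rfl fun x' _ => by ring
  -- Markov on the square `(m - X + lam)^2`
  have hPE : μ.real E = ∑ s, W s * ind E s := prodBernoulli_real_eq_sum_weight_ind p E
  have hXcard : ∀ s, X s = ((univ.filter (fun x => ((P x : Finset ι) : Set ι) ⊆ s)).card : ℝ) := by
    intro s
    rw [hX]
    have : ∀ x, ind {ω : Set ι | ((P x : Finset ι) : Set ι) ⊆ ω} s = if ((P x : Finset ι) : Set ι) ⊆ s then 1 else 0 := by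
      intro x
      by_cases h : ((P x : Finset ι) : Set ι) ⊆ s
      · rw [if_pos h, ind_of_mem (show s ∈ {ω : Set ι | ((P x : Finset ι) : Set ι) ⊆ ω} from h)]
      · rw [if_neg h, ind_of_not_mem (show s ∉ {ω : Set ι | ((P x : Finset ι) : Set ι) ⊆ ω} from h)]
    simp_rw [this]
    rw [Finset.sum_boole]
  have hmarkov : 4 * lam ^ 2 * μ.real E ≤ ∑ s, W s * (m - X s + lam) ^ 2 := by
    rw [hPE, Finset.mul_sum]
    refine Finset.sum_le_sum fun s _ => ?_
    by_cases hs : s ∈ E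
    · rw [ind_of_mem hs, mul_one]
      have hXle : X s ≤ j := by
        rw [hXcard s]
        exact_mod_cast (show s ∈ E from hs)
      have h2 : 2 * lam ≤ m - X s + lam := by rw [hlam]; linarith
      have hl : 0 ≤ lam := by rw [hlam]; linarith
      have h3 : (2 * lam) ^ 2 ≤ (m - X s + lam) ^ 2 := pow_le_pow_left₀ (by linarith) h2 2
      nlinarith [hW0 s, h3]
    · rw [ind_of_not_mem hs, mul_zero, mul_zero]
      exact mul_nonneg (hW0 s) (sq_nonneg _)
  have hexp2 : ∑ s, W s * (m - X s + lam) ^ 2 = ∑ s, W s * (X s - m) ^ 2 + lam ^ 2 := by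
    have : ∀ s, W s * (m - X s + lam) ^ 2 =
        W s * (X s - m) ^ 2 - 2 * lam * (W s * X s) + (2 * lam * m + lam ^ 2) * W s := by
      intro s; ring
    simp_rw [this]
    rw [Finset.sum_add_distrib, Finset.sum_sub_distrib, ← Finset.mul_sum, ← Finset.mul_sum, hmean, hW1]
    ring
  rw [hexp2] at hmarkov
  linarith


/-- **FAR for independent legs (spiders), every layer.**  For independent gates `p` on legs (`leg`, `depth`), with
`P x = {y | leg y = leg x ∧ depth y ≤ depth x}` the gate-prefix of `x`, `T x = ∏_{y ∈ P x} p y` the marginal of the relay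
below `x` and `N(ω) = #{x | ↑(P x) ⊆ ω}` the number of relays connected to the root: if `2j < Σ_x T x` (`= E N`) and
`1 − T x ≤ t` for every `x`, then `P(N ≤ j) ≤ t`.  This is `Quant.FarRelayRow` on spiders in gate coordinates; the legs have
ARBITRARY laws.  Regimes: decisive leg (A) / `indepLegs_smallBall_of_card` (C, `t ≤ 1/2`) / `indepLegs_cantelli` (B). [this work] -/
theorem far_indepLegs (leg : ι → J) (depth : ι → ℕ) (p : ι → unitInterval) (j : ℕ) (t : ℝ)
    (hmean : (2 * j : ℝ) < ∑ x, ∏ y ∈ univ.filter (fun y => leg y = leg x ∧ depth y ≤ depth x), (p y : ℝ))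
    (ht : ∀ x, 1 - ∏ y ∈ univ.filter (fun y => leg y = leg x ∧ depth y ≤ depth x), (p y : ℝ) ≤ t) :
    (prodBernoulli p).real {ω : Set ι |
      (univ.filter (fun x => ((univ.filter (fun y => leg y = leg x ∧ depth y ≤ depth x) : Finset ι) : Set ι) ⊆ ω)).card ≤ j} ≤ t := by
  set μ := prodBernoulli p with hμ
  set P : ι → Finset ι := fun x => univ.filter (fun y => leg y = leg x ∧ depth y ≤ depth x) with hP
  set T : ι → ℝ := fun x => ∏ y ∈ P x, (p y : ℝ) with hT
  set E : Set (Set ι) := {ω : Set ι | (univ.filter (fun x => ((P x : Finset ι) : Set ι) ⊆ ω)).card ≤ j} with hE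
  set m : ℝ := ∑ x, T x with hm
  have hp0 : ∀ i, (0 : ℝ) ≤ p i := fun i => (p i).2.1
  have hp1 : ∀ i, (p i : ℝ) ≤ 1 := fun i => (p i).2.2
  have hT1 : ∀ x, T x ≤ 1 := fun x => Finset.prod_le_one (fun y _ => hp0 y) fun y _ => hp1 y
  by_cases ht1 : 1 ≤ t
  · exact measureReal_le_one.trans ht1
  push Not at ht1
  have hcard : 2 * j + 1 ≤ Fintype.card ι := by
    have h1 : ∑ x, T x ≤ ∑ _x : ι, (1 : ℝ) := Finset.sum_le_sum fun x _ => hT1 x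
    rw [Finset.sum_const, nsmul_eq_mul, mul_one, Finset.card_univ] at h1
    have h2 : (2 * j : ℝ) < (Fintype.card ι : ℝ) := lt_of_lt_of_le hmean h1
    exact_mod_cast h2
  by_cases ht2 : t ≤ 1 / 2
  · -- regime (C): high marginals, top-blob domination + Hall/Harris–Kleitman transport
    exact indepLegs_smallBall_of_card leg depth p j t ht2 ht hcard
  push Not at ht2
  by_cases hbig : ∃ x, j + 1 ≤ (univ.filter (fun y => leg y = leg x)).card
  · -- regime (A): a decisive leg — on `{N ≤ j}` its deepest gate-prefix is not fully open
    obtain ⟨x, hx⟩ := hbig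
    set F : Finset ι := univ.filter (fun y => leg y = leg x) with hF
    have hxF : x ∈ F := by simp [hF]
    obtain ⟨z, hz, hmax⟩ := Finset.exists_max_image F depth ⟨x, hxF⟩
    have hlz : leg z = leg x := by simpa [hF] using hz
    have hPz : P z = F := by
      refine Finset.Subset.antisymm (fun y hy => ?_) fun y hy => ?_
      · simp only [hP, Finset.mem_filter, Finset.mem_univ, true_and] at hy
        simp only [hF, Finset.mem_filter, Finset.mem_univ, true_and]
        exact hy.1.trans hlz
      · have hly : leg y = leg x := by simpa [hF] using hy
        simp only [hP, Finset.mem_filter, Finset.mem_univ, true_and]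
        exact ⟨hly.trans hlz.symm, hmax y hy⟩
    have hsub : E ⊆ {ω : Set ι | ((P z : Finset ι) : Set ι) ⊆ ω}ᶜ := by
      intro ω hω hωz
      have hωE : (univ.filter (fun x' => ((P x' : Finset ι) : Set ι) ⊆ ω)).card ≤ j := hω
      have hzω : ((F : Finset ι) : Set ι) ⊆ ω := by rw [← hPz]; exact hωz
      have hincl : F ⊆ univ.filter (fun x' => ((P x' : Finset ι) : Set ι) ⊆ ω) := by
        intro y hy
        have hly : leg y = leg x := by simpa [hF] using hy
        simp only [Finset.mem_filter, Finset.mem_univ, true_and]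
        intro y' hy'
        have : y' ∈ F := by
          have hy'P : y' ∈ P y := Finset.mem_coe.1 hy'
          simp only [hP, Finset.mem_filter, Finset.mem_univ, true_and] at hy'P
          simp only [hF, Finset.mem_filter, Finset.mem_univ, true_and]
          exact hy'P.1.trans hly
        exact hzω (Finset.mem_coe.2 this)
      have := Finset.card_le_card hincl
      omega
    calc μ.real E ≤ μ.real {ω : Set ι | ((P z : Finset ι) : Set ι) ⊆ ω}ᶜ := measureReal_mono hsub (measure_ne_top _ _)
      _ = 1 - μ.real {ω : Set ι | ((P z : Finset ι) : Set ι) ⊆ ω} := probReal_compl_eq_one_sub MeasurableSet.of_discrete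
      _ = 1 - T z := by rw [hμ, prodBernoulli_real_subset]
      _ ≤ t := ht z
  · -- regime (B): no decisive leg and a low marginal (`t > 1/2`): Cantelli
    push Not at hbig
    have hfib : ∀ x, (univ.filter (fun y => leg y = leg x)).card ≤ j := fun x => Nat.lt_succ_iff.1 (hbig x)
    have hj0 : (0 : ℝ) ≤ j := Nat.cast_nonneg _
    have hc := indepLegs_cantelli leg depth p j t hfib ht (by linarith)
    have hm0 : 0 < m := by linarith
    have hlam : m / 2 < m - j := by linarith
    have hlam0 : 0 < m - j := by linarith
    have hjm : (j : ℝ) * m ≤ 2 * (m - j) ^ 2 := by nlinarith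
    have ht0 : 0 ≤ t := by linarith
    have h1 : (j : ℝ) * t * m ≤ 2 * t * (m - j) ^ 2 := by nlinarith
    have h2 : 4 * (m - j) ^ 2 * μ.real E ≤ (2 * t + 1) * (m - j) ^ 2 := by linarith
    have h3 : 4 * μ.real E ≤ 2 * t + 1 := le_of_mul_le_mul_right (by linarith) (pow_pos hlam0 2)
    linarith

/-- **FAR for spiders, root-in-`A` cell.**  If the root itself is a relay (count `N + 1`, mean `1 + Σ_x T x`), layer `j + 1`:
`2(j+1) < 1 + Σ_x T x` and `1 − T x ≤ t` for all `x` imply `P(N + 1 ≤ j + 1) ≤ t`. [this work] -/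
theorem far_indepLegs_root (leg : ι → J) (depth : ι → ℕ) (p : ι → unitInterval) (j : ℕ) (t : ℝ)
    (hmean : (2 * j + 1 : ℝ) < ∑ x, ∏ y ∈ univ.filter (fun y => leg y = leg x ∧ depth y ≤ depth x), (p y : ℝ))
    (ht : ∀ x, 1 - ∏ y ∈ univ.filter (fun y => leg y = leg x ∧ depth y ≤ depth x), (p y : ℝ) ≤ t) :
    (prodBernoulli p).real {ω : Set ι |
      (univ.filter (fun x => ((univ.filter (fun y => leg y = leg x ∧ depth y ≤ depth x) : Finset ι) : Set ι) ⊆ ω)).card + 1 ≤ j + 1} ≤ t := by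
  have hE : {ω : Set ι |
      (univ.filter (fun x => ((univ.filter (fun y => leg y = leg x ∧ depth y ≤ depth x) : Finset ι) : Set ι) ⊆ ω)).card + 1 ≤ j + 1} =
      {ω : Set ι |
      (univ.filter (fun x => ((univ.filter (fun y => leg y = leg x ∧ depth y ≤ depth x) : Finset ι) : Set ι) ⊆ ω)).card ≤ j} := by
    ext ω; simp only [Set.mem_setOf_eq]; omega
  rw [hE]
  exact far_indepLegs leg depth p j t (by linarith) ht

end Quant

end Summit.CriticalPhenomena.PercolationContinuityZ3.Theorems

end
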